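/-
Copyright (c) 2026 the pub-hodgecm-mathlib formalisation cell (harness21).  Prover seat hodgecm-mathlib-K2E1-p09 (g5), Track B ∕ K2-LIT, h413 =
`stmt-HodgeConjecture-24833`, line `K2_E1_TraceFormulaBeta`, campaign «EIS-RANK-ONE» rung R6g, deal «R6g-TWINS-2» of the dealer K2E1-plan (g4) 2026-09-04T06:28:29Z, brick
(R6g-b)_two: the Maass–Selberg relation of `U(1,1)` on the CLOSED sub-tube, including the diagonal `‖Λ^T E(φ, z)‖²_X` — the `N = 2` twin of ★ p857918
`K2E1MaassSelbergDiagonalCMThree` (`2ρ_H = 1`), whose generic §§1–3 are imported, not restated.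
-/
import Summits.HodgeConjecture.HodgeConjecture.Theorems.K2E1MaassSelbergDiagonalCMThree            -- ★ p857918 (K2E4-p10 g4): §§1–3 generic (dominated convergence, closure, quotient pairing)
import Summits.HodgeConjecture.HodgeConjecture.Theorems.K2E1TruncatedEisensteinLocallyUniformCMTwo   -- ★ (this seat): (R6g-a)_two z-locally-uniform `‖Λ^T E(φ,z)‖_∞` at `N = 2`
import HarnessLib

/-!
# K2·E1 — `K2E1MaassSelbergDiagonalCMTwo`: THE MAASS–SELBERG RELATION OF `U(1,1)` ON THE CLOSED SUB-TUBE, INCLUDING THE DIAGONAL `‖Λ^T E(φ, z)‖²_X`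
# (campaign «EIS-RANK-ONE», rung R6g, brick (R6g-b)_two: continuity of `z′ ↦ ⟨Λ^T E(φ,z), Λ^T E(φ′,z′)⟩_X` by dominated convergence on finite-measure `X_G` + limit uniqueness)

Track B ∕ K2-LIT, crux h413 = `stmt-HodgeConjecture-24833`, route of record `HCCMUnconditional`; cell `hodgecm-mathlib`, squad K2, ENGINE E1.  Prover seat
`hodgecm-mathlib-K2E1-p09` (g5); deal «R6g-TWINS-2» of the dealer K2E1-plan (g4) 2026-09-04T06:28:29Z («templates ★ p857890 ∕ p857918 word for word at `2ρ_H = 1`»).  THEOREMS ONLY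
(no `def`, no `instance`, no notation, no named-fact hypothesis, no `sorry`); lane `--supports stmt-HodgeConjecture-24833 --as helper` (count-neutral).  Closes no socket.

THE MATHEMATICS [Arthur1980TraceFormulaII, §4; MoeglinWaldspurger1995, IV.2.3; Garrett2018, §11.3] — verbatim ★ p857918 §4 with `3 ↦ 2`, `2 < Re ↦ 1 < Re`.  The off-diagonal relation
(★ p857851 `K2E1MaassSelbergSymmetryTwo` ∕ ★ `K2E1MaassSelbergUTwo`) holds on `{Re z′ ≠ Re z}`; at a boundary point (the diagonal `z′ = z`) both sides are limits along the sub-tube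
`S = {1 < Re z′ < Re z}`: the left side by DOMINATED CONVERGENCE on the finite-measure quotient `X_G` (★ p857918 §1–§3 `integral_quotFun_mul_conj_eq_of_closure`, imported: the
integrand is bounded by `sup‖Λ^T E(φ,z)‖ · sup_{z′ near z}‖Λ^T E(φ′,z′)‖`, the latter LOCALLY UNIFORM in `z′` by ★ (R6g-a)_two, and moves continuously in `z′` pointwise), the right
side by continuity of the bracket expression; limits in `ℂ` are unique.  THIS FILE = the DIAGONAL specialisation for flat sections of `U(J₂)` over the CM pair `(L⁺, L, conj)`:
`∫_X ‖Λ^T E(φ,z)‖² dμ = R(z)` — the Maass–Selberg NORM FORMULA at `N = 2` [MoeglinWaldspurger1995, IV.2.3 and IV.3.8] — with `hΛ′bdd` DISCHARGED by ★ (R6g-a)_two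
`exists_norm_truncation_eisensteinSeriesU_flatSectionU_le_uniform_cm_two` on a compact ball inside `V ∩ {Re > 1}` (modulo the z′-uniform decay `hdec` on `V`), measurability by
★ p857723 `measurable_truncation_eisensteinSeriesU_flatSectionU_cm_two'` + ★ `measurable_quotFun_of_measurable`, `z ∈ closure S` by real shifts (`mem_closure_subtube_two`).
NAMED (honest): `hcont`, the pointwise continuity of `z′ ↦ Λ^T E(φ,z′)(g)` (brick (R6g-c)_two), and the relation of record `hrel` on `S` with its right-hand side `R`.
WHY `N = 2` FIRST-CLASS (dealer 06:27:55Z): at `U(J₂)` the intertwining coefficient is a SCALAR Hecke-`L` quotient, so the continuation rung (R7) is first attackable here.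
SAT-WITNESS (ruling «VAC-U» (3)): structural binders = Haar `ν` + `ν`-fundamental domain of `N(L⁺)` (★ `exists_isFundamentalDomain_two`), a finite measure on the automorphic
quotient (any), `V ∈ 𝓝 z` (e.g. `univ`) — independently satisfiable; no subgroup is quantified.
HONEST LABEL: HC_CM is proved only modulo the 7 printed citations (2 remaining named inputs: hLiu418 = `stmt-HodgeConjecture-24832`, h413 = `stmt-HodgeConjecture-24833`) until rung 0
closes; this file asserts no named fact and closes no socket.
References: [Arthur1980TraceFormulaII] §4 · [MoeglinWaldspurger1995] IV.2.3, IV.3.8 · [Garrett2018] §11.3.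
-/

set_option autoImplicit false
-- the mandated namespace repeats the single-problem summit's segment (`HodgeConjecture.HodgeConjecture`)
set_option linter.dupNamespace false

noncomputable section

open MeasureTheory Measure NumberField IsDedekindDomain Set Filter Topology MulAction
open scoped ENNReal NNReal ComplexConjugate
open Literature.NumberTheory.Automorphic Literature.NumberTheory.Automorphic.UnitaryGroup AdelicGroupData
open Summit.HodgeConjecture.HodgeConjecture.Cruxes.H413.K2E1BorelEisensteinU
open Summit.HodgeConjecture.HodgeConjecture.Cruxes.H413.K2E1TruncatedEisensteinL2
open Summit.HodgeConjecture.HodgeConjecture.Cruxes.H413.K2E1TruncatedEisensteinBoundedCMThree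
open Summit.HodgeConjecture.HodgeConjecture.Cruxes.H413.K2E1TruncatedEisensteinBoundedCMTwo
open Summit.HodgeConjecture.HodgeConjecture.Cruxes.H413.K2E1TruncatedEisensteinLocallyUniformCMTwo
open Summit.HodgeConjecture.HodgeConjecture.Cruxes.H413.K2E1MaassSelbergDiagonalCMThree

namespace Summit.HodgeConjecture.HodgeConjecture.Cruxes.H413.K2E1MaassSelbergDiagonalCMTwo

section Diagonal

variable (L : Type) [Field L] [NumberField L] [IsCMField L]
variable [MeasurableSpace (quasiSplit (↥(maximalRealSubfield L)) L (IsCMField.complexConj L) 2).Adelic] [BorelSpace (quasiSplit (↥(maximalRealSubfield L)) L (IsCMField.complexConj L) 2).Adelic]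
  [MeasurableSpace (adelicUnipotent (↥(maximalRealSubfield L)) L (IsCMField.complexConj L) 2)] [BorelSpace (adelicUnipotent (↥(maximalRealSubfield L)) L (IsCMField.complexConj L) 2)]

omit [NumberField L] [IsCMField L] [MeasurableSpace (quasiSplit (↥(maximalRealSubfield L)) L (IsCMField.complexConj L) 2).Adelic] [BorelSpace (quasiSplit (↥(maximalRealSubfield L)) L (IsCMField.complexConj L) 2).Adelic]
  [MeasurableSpace (adelicUnipotent (↥(maximalRealSubfield L)) L (IsCMField.complexConj L) 2)] [BorelSpace (adelicUnipotent (↥(maximalRealSubfield L)) L (IsCMField.complexConj L) 2)] in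
/-- `z` lies in the closure of the sub-tube `{z′ | 1 < Re z′ < Re z}` when `Re z > 1` (real shifts `z − δ`, `δ ↓ 0`). [folklore] -/
theorem mem_closure_subtube_two {z : ℂ} (hz : 1 < z.re) : z ∈ closure {z' : ℂ | 1 < z'.re ∧ z'.re < z.re} := by
  refine Metric.mem_closure_iff.2 fun ε hε => ?_
  set δ : ℝ := min (ε / 2) ((z.re - 1) / 2) with hδ
  have hδ0 : 0 < δ := lt_min (half_pos hε) (by linarith)
  have hδε : δ < ε := (min_le_left _ _).trans_lt (half_lt_self hε)
  have hδz : δ < z.re - 1 := (min_le_right _ _).trans_lt (by linarith)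
  refine ⟨z - (δ : ℂ), ⟨?_, ?_⟩, ?_⟩
  · rw [Complex.sub_re, Complex.ofReal_re]; linarith
  · rw [Complex.sub_re, Complex.ofReal_re]; linarith
  · rw [Complex.dist_eq, sub_sub_cancel, Complex.norm_real, Real.norm_eq_abs, abs_of_pos hδ0]; exact hδε

/-- **THE MAASS–SELBERG NORM FORMULA ON THE DIAGONAL, `U(J₂)` OVER THE CM PAIR** (`Re z > 1`, `T ≥ 1`, `φ` continuous, bounded, left-`B(L⁺)`-invariant, `ν` Haar on `N(𝔸)`, `𝓕` a
fundamental domain of `N(L⁺)`, `μ` a finite measure on the automorphic quotient): if the relation of record `⟨Λ^T E(φ,z), Λ^T E(φ,z′)⟩_X = R(z′)` holds on the sub-tube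
`1 < Re z′ < Re z` (★ `K2E1MaassSelbergUTwo` ∕ ★ p857851 with their per-`z′` inputs), `R` is continuous within the sub-tube at `z′ = z`, `z′ ↦ Λ^T E(φ,z′)(g)` is continuous there for every
`g` (`hcont`, named), and the decay `hdec` holds z′-UNIFORMLY on a neighbourhood `V` of `z`, then **`∫_X ‖Λ^T E(φ,z)‖² dμ = R(z)`**.  Discharged inside: the z′-uniform sup bound (★
(R6g-a)_two on a compact ball in `V ∩ {Re > 1}`), the Borel descents (★ p857723 `measurable_truncation_…_cm_two′` + ★ `measurable_quotFun_of_measurable` + ★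
`truncation_eisensteinSeriesU_flatSectionU_arithmeticSubgroup_mul`), and `z ∈ closure S`. [cite: Arthur1980TraceFormulaII, §4] [cite: MoeglinWaldspurger1995, IV.2.3 and IV.3.8]
[cite: Garrett2018, §11.3] -/
theorem maassSelberg_diagonal_flatSectionU_cm_two
    (ν : Measure (adelicUnipotent (↥(maximalRealSubfield L)) L (IsCMField.complexConj L) 2)) [ν.IsHaarMeasure]
    {𝓕 : Set (adelicUnipotent (↥(maximalRealSubfield L)) L (IsCMField.complexConj L) 2)}
    (h𝓕 : IsFundamentalDomain (rationalUnipotent (↥(maximalRealSubfield L)) L (IsCMField.complexConj L) 2) 𝓕 ν) {T : ℝ≥0} (hT : 1 ≤ T)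
    {z : ℂ} (hz : 1 < z.re)
    {φ : (quasiSplit (↥(maximalRealSubfield L)) L (IsCMField.complexConj L) 2).Adelic → ℂ} (hφc : Continuous φ) {M : ℝ} (hφM : ∀ x, ‖φ x‖ ≤ M)
    (hφB : ∀ b ∈ borelU ((IsCMField.complexConj L : L ≃ₐ[↥(maximalRealSubfield L)] L) : L →+* L) ((StdForm.antidiagonal 2).over L), ∀ x : (quasiSplit (↥(maximalRealSubfield L)) L (IsCMField.complexConj L) 2).Adelic, φ ((quasiSplit (↥(maximalRealSubfield L)) L (IsCMField.complexConj L) 2).toAdelic b * x) = φ x)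
    (μ : Measure (quasiSplit (↥(maximalRealSubfield L)) L (IsCMField.complexConj L) 2).automorphicQuotient) [IsFiniteMeasure μ]
    -- the ONE analytic named input of ★ (R6g-a)_two: the decay, z′-uniform on a neighbourhood of `z`
    {V : Set ℂ} (hV : V ∈ 𝓝 z) {M₁ : ℝ}
    (hdec : ∀ z' ∈ V, ∀ g : (quasiSplit (↥(maximalRealSubfield L)) L (IsCMField.complexConj L) 2).Adelic, T < borelHeight g →
      ‖eisensteinSeriesU (flatSectionU φ z') g - borelConstantTerm ν 𝓕 (eisensteinSeriesU (flatSectionU φ z')) g‖ ≤ M₁)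
    -- NAMED: pointwise continuity of the truncation in `z′` from inside the sub-tube (brick (R6g-c)_two)
    (hcont : ∀ g : (quasiSplit (↥(maximalRealSubfield L)) L (IsCMField.complexConj L) 2).Adelic,
      ContinuousWithinAt (fun z' : ℂ => truncation ν 𝓕 T (eisensteinSeriesU (flatSectionU φ z')) g) {z' : ℂ | 1 < z'.re ∧ z'.re < z.re} z)
    -- the relation of record on the sub-tube and its right-hand side
    {R : ℂ → ℂ} (hR : ContinuousWithinAt R {z' : ℂ | 1 < z'.re ∧ z'.re < z.re} z)
    (hrel : ∀ z' : ℂ, 1 < z'.re → z'.re < z.re →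
      ∫ x, (quasiSplit (↥(maximalRealSubfield L)) L (IsCMField.complexConj L) 2).quotFun (truncation ν 𝓕 T (eisensteinSeriesU (flatSectionU φ z))) x *
          conj ((quasiSplit (↥(maximalRealSubfield L)) L (IsCMField.complexConj L) 2).quotFun (truncation ν 𝓕 T (eisensteinSeriesU (flatSectionU φ z'))) x) ∂μ = R z') :
    ((∫ x, ‖(quasiSplit (↥(maximalRealSubfield L)) L (IsCMField.complexConj L) 2).quotFun (truncation ν 𝓕 T (eisensteinSeriesU (flatSectionU φ z))) x‖ ^ 2 ∂μ : ℝ) : ℂ) = R z := by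
  -- a compact ball `Kc ⊆ V ∩ {Re > 1}` around `z`
  obtain ⟨ε, hε, hball⟩ := Metric.mem_nhds_iff.1 hV
  set r : ℝ := min (ε / 2) ((z.re - 1) / 2) with hr
  have hr0 : 0 < r := lt_min (half_pos hε) (by linarith)
  have hKcV : Metric.closedBall z r ⊆ V := (Metric.closedBall_subset_ball ((min_le_left _ _).trans_lt (half_lt_self hε))).trans hball
  have hKc1 : ∀ z' ∈ Metric.closedBall z r, 1 < z'.re := by
    intro z' hz'
    have hdist : dist z' z ≤ r := Metric.mem_closedBall.1 hz'
    have h1 := Complex.abs_re_le_norm (z' - z)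
    rw [Complex.sub_re, ← Complex.dist_eq] at h1
    have h2 := (abs_le.1 (h1.trans hdist)).1
    have h3 : r ≤ (z.re - 1) / 2 := min_le_right _ _
    linarith
  obtain ⟨M₀, hM₀⟩ := exists_norm_truncation_eisensteinSeriesU_flatSectionU_le_uniform_cm_two L ν h𝓕 hT (isCompact_closedBall z r) hKc1 hφc hφM hφB
    (M₁ := M₁) fun z' hz' g hg => hdec z' (hKcV hz') g hg
  have hKcS : Metric.closedBall z r ∈ 𝓝[{z' : ℂ | 1 < z'.re ∧ z'.re < z.re}] z := mem_nhdsWithin_of_mem_nhds (Metric.closedBall_mem_nhds z hr0)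
  -- Borel descent of every `Λ^T E(φ, z′)`, `Re z′ > 1`
  have hmeas : ∀ z' : ℂ, 1 < z'.re →
      AEStronglyMeasurable ((quasiSplit (↥(maximalRealSubfield L)) L (IsCMField.complexConj L) 2).quotFun (truncation ν 𝓕 T (eisensteinSeriesU (flatSectionU φ z')))) μ :=
    fun z' hz' => (measurable_quotFun_of_measurable (measurable_truncation_eisensteinSeriesU_flatSectionU_cm_two' L ν 𝓕 hT hz' hφc hφM)
      (truncation_eisensteinSeriesU_flatSectionU_arithmeticSubgroup_mul ν h𝓕 T hφB z')).aestronglyMeasurable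
  have key := integral_quotFun_mul_conj_eq_of_closure (quasiSplit (↥(maximalRealSubfield L)) L (IsCMField.complexConj L) 2) μ (mem_closure_subtube_two hz)
    (Λ' := fun z' : ℂ => truncation ν 𝓕 T (eisensteinSeriesU (flatSectionU φ z')))
    (hmeas z hz) (hM₀ z (Metric.mem_closedBall_self hr0.le))
    (eventually_nhdsWithin_of_forall fun z' hz' => hmeas z' hz'.1)
    (by filter_upwards [hKcS] with z' hz'; exact hM₀ z' hz')
    hcont hR fun z' hz' => hrel z' hz'.1 hz'.2
  rw [integral_mul_conj_self_eq] at key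
  exact key

end Diagonal

end Summit.HodgeConjecture.HodgeConjecture.Cruxes.H413.K2E1MaassSelbergDiagonalCMTwo

end
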